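import Summits.BirchSwinnertonDyer.BirchSwinnertonDyer.Theorems.ByReductionTypeAtTwoMultTowerPinch
import Summits.BirchSwinnertonDyer.BirchSwinnertonDyer.Theorems.ByReductionTypeAtTwoMultSelmerRankSplitWeakEZ
import Summits.BirchSwinnertonDyer.Rank1Residual.X5.TwoAdicTargetsSplitKappaCert
import HarnessLib

/-!
# Route `ByReductionTypeAtTwo`, children `MultLowerHalfAtTwo` (item stmt-BirchSwinnertonDyer-19923) and
# `MultUpperHalfAtTwo` (19922): the SPLIT TOWER λ-pinch road at a multiplicative `2` WITHOUT the named fact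
# `greenberg_stevens W 2` — BSD₂ on the `κ₁`-valuation certificate (mult GEN 8, p451828), the rank-`0`
# `2`-converse on the PRINTED weak exceptional zero (Spieß 2014 Thm. 5.7, p456266)

HONEST FRAMING (cell `bsd-2adic`, run/shared/lean/pub/bsd-2adic/, seat `bsd-2adic-mult-3` GEN 7, HUMAN RULINGS
D-0036 / D-0054 / D-0074 row (A)): research route; THEOREMS ONLY — no definition, no new named fact, nothing
asserted, nothing booked; BSD is not proved by any of this. PARTITION (D-0054): X5@2 mult, SPLIT, with odd
torsion order — the habitat of the TOWER λ-pinch road `…MultTowerPinch.lean` (GEN 6, p446877: NO `2`-adic image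
and NO `Δ`-sign hypothesis; runnable on a class as soon as tower-eng certifies a tower gap at a multiplicative
`2` — mult-2 GEN 5 kit j256117 is the first such run) × p = 2 — types-the-object-of (items 19923 / 19922 per
class at the door level; the S3ᵐ converse per class); closes none by itself.

WHAT THIS FILE DOES. §2 of `…MultTowerPinch.lean` (split `2`) displays `hGS : greenberg_stevens W 2` (printed
for `p ≥ 5` / odd `p` only; at `2` the memo PROOF-GS2). As in the SelmerRank road (`…SelmerRankSplitKappa.lean`
p462280, `…SelmerRankSplitWeakEZ.lean` p464076) the named fact enters only through the last step, so it is
replaced, one application each and with the GEN-6 proofs otherwise verbatim: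
* `bsdp_two_split_of_katoRat_of_towerGap_of_layerSelmer_of_kappaCert` — `BSDp W 2` from MEMO {K11 `hKato` =
  `X5.O1.KatoMultiplicativeDivisibilityRat W 2`} + PRINT {A236 `h41sp`, `hmod`, `hGZK`, Prop. 4.14@2 `h414`} +
  CERTIFICATES {`κ₁`-valuation `hκ` (`X5.O1.AnalyticKappaOneValuationAtTwo W`), tower gap `hgap`, layer count
  `hsel`, `λ_an = n + 1`, `μ_an = 0`, `hper₀`} + odd torsion; last step
  `X5.O1.missingPPartAt_two_split_of_charIdeal_eq_span_of_kappaCert` (mult GEN 8);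
* `analyticRank_eq_zero_of_finite_selmer_of_katoRat_split_of_towerGap_of_layerSelmer_of_weakEZ` — the CONVERSE
  (`Sel_{2^∞}(E/ℚ)` finite ⇒ `L(E,1) ≠ 0 ∧ r_an = 0`) with `hW : Spiess2014.thm57_weakExceptionalZero_splitMultiplicative_rat W 2`
  (PRINT, any `p`) in place of `hGS`; last step `entireLFunction_one_ne_zero_of_finite_selmer_of_charIdeal_eq_span_split_of_weakEZ`
  (p464076);
* `missingLowerBoundAt_two_split_of_katoRat_of_towerGap_of_layerSelmer_of_kappaCert` /
  `missingUpperBoundAt_two_split_of_katoRat_of_towerGap_of_layerSelmer_of_kappaCert` — the instances of items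
  19923 / 19922 at such a curve.
Each theorem is implied by its `hGS` original (`X5.O1.analyticKappaOneValuationAtTwo_of_greenbergStevens`,
`Spiess2014.thm57_weakExceptionalZero_splitMultiplicative_rat_of_greenberg_stevens`); with this file no door
of the mult-3 roads (SelmerRank, TOWER λ-pinch) displays `greenberg_stevens W 2` any more.

WHAT IS DISPLAYED, NOT PROVED. MEMO: K11 (`hKato`, HOME/mult/PROOF-MULT.md Thm. A/B, referee RC-2 PASS).
PRINT: A236 (`h41sp`), Prop. 4.14 at `2` (`h414`), modularity, GZK, Spieß Thm. 5.7 at `(W, 2)` (`hW`; D-audit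
claimed by bsd-2adic-audit-1 GEN 8). CERTIFICATES: tower gap (`TowerGapAtTwo W`), layer count, `κ₁`, `λ_an`,
`μ_an`, `hper₀`. ∀-LEVEL CONTENT for 19923: none (open mathematics; seat verdict GEN 0–7).

References: K. Kato, Astérisque 295 (2004), Thm. 17.4 and 17.13; R. Greenberg, LNM 1716 (1999), §4 pp. 112–113,
Prop. 4.14 (p. 124); M. Spieß, Invent. Math. 196 (2014), Thm. 5.7; B. Mazur, J. Tate, J. Teitelbaum, Invent.
Math. 84 (1986), §I.13–15, §II; R. L. Miller, LMS J. Comput. Math. 14 (2011), Def. 1.1.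
-/

set_option autoImplicit false
-- the route's Theorems namespace repeats a component by design (summit = sub-problem, D-0017 nested layout)
set_option linter.dupNamespace false

noncomputable section

open scoped Classical MatrixGroups ModularForm

open CongruenceSubgroup WeierstrassCurve Literature.NumberTheory.EllipticCurves
  Literature.NumberTheory.EllipticCurves.ModularForms
  Literature.NumberTheory.EllipticCurves.Greenberg1999
  Literature.NumberTheory.EllipticCurves.Rank1Residual
  Literature.NumberTheory.EllipticCurves.Rank1Residual.Typed
  Literature.NumberTheory.EllipticCurves.Spiess2014
  Summit.BirchSwinnertonDyer.Rank1Residual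
  Summit.BirchSwinnertonDyer.Rank1Residual.X5 Summit.BirchSwinnertonDyer.Rank1Residual.X5.O1

namespace Summit.BirchSwinnertonDyer.BirchSwinnertonDyer.Theorems.MultSelmerRank

variable (W : WeierstrassCurve ℚ) [W.IsElliptic] [W.IsGloballyMinimal]

/-- **DOOR (TOWER λ-pinch, split) on the `κ₁`-CERTIFICATE: `BSDp W 2`, both halves,** for `W/ℚ` globally minimal
of analytic rank `0`, SPLIT multiplicative at `2`, with odd torsion order. Binders: PRINT {A236 `h41sp`, `hmod`,
`hGZK`, `h414`}; MEMO {K11 `hKato`}; CERTIFICATES {`κ₁` (`hκ`), `TowerGapAtTwo W` (`hgap`), the layer count `hsel`,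
`λ_an(E) = n + 1` (`hlan`), `μ_an = 0` (`hμan`), `hper₀`}. Chain = GEN 6's `bsdp_two_split_of_katoRat_of_towerGap_of_layerSelmer`
verbatim (K11 + `μ = 0` from the tower gap ⇒ integral split clause; `λ`-pinch ⇒ `char X = (L₁)`), last step
`X5.O1.missingPPartAt_two_split_of_charIdeal_eq_span_of_kappaCert` in place of the `hGS` form. No `hGS`.
[cite: Kato2004Asterisque, Thm. 17.4 (p. 273) and 17.13 (pp. 279–280)] [cite: GreenbergLNM1716, §4 pp. 112–113 (split l_v) and Prop. 4.14 (p. 124)]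
[cite: MazurTateTeitelbaum1986Invent, §I.13–15 and §II] [cite: Miller2011LMS, Def. 1.1 and §1] -/
theorem bsdp_two_split_of_katoRat_of_towerGap_of_layerSelmer_of_kappaCert {j n : ℕ}
    (hKato : O1.KatoMultiplicativeDivisibilityRat W 2)
    (h41sp : thm41Analogue_charValue_rankZero_split_baseChange_anyPrime)
    (hκ : AnalyticKappaOneValuationAtTwo W)
    (hmod : nonempty_modularParametrizationData)
    (hGZK : rank_eq_analyticRank_of_analyticRank_le_one)
    (h414 : prop414_noFiniteSubmodule_of_not_dvd_torsionOrder)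
    (hper₀ : ∀ [NeZero (W.conductorNorm ℤ)] (f : CuspForm (Gamma0 (W.conductorNorm ℤ)) 2),
      IsNewformOf W f → ∀ ϖ : ℚ, (ϖ : ℝ) * W.realPeriodRat = plusPeriod f → 0 ≤ padicValRat 2 ϖ)
    (hgap : TowerGapAtTwo W) (htors : ¬ 2 ∣ W.torsionOrder)
    (hr : W.analyticRank = 0) (hmult : Mult W 2) (hsp : W.HasSplitMultiplicativeReductionAtPrime 2)
    (hlan : X2.AnalyticLambdaEq W 2 (n + 1)) (hμan : X2.AnalyticMuLE W 2 0)
    (hsel : ∀ κ : ZpExtension ℚ 2, κ.IsCyclotomic →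
      2 ^ n ≤ Nat.card {z : W.selmerLayer κ j // 2 • z = 0}) : BSDp W 2 := by
  haveI : NeZero (W.conductorNorm ℤ) := ⟨(W.conductorNorm_pos_holds).ne'⟩
  obtain ⟨Dm⟩ := hmod W
  have hf : IsNewformOf W Dm.f := Dm.isNewformOf
  have hL : W.entireLFunction 1 ≠ 0 :=
    (W.analyticRank_eq_zero_iff_holds hf.hasEntireLFunction).mp hr
  obtain ⟨ϖ, -, hϖ, -⟩ := Dm.exists_rat_mul_realPeriodRat_eq_plusPeriod
  obtain ⟨κ, hκ', γ, hγ, hγ'⟩ := exists_isCyclotomic_isTopGenerator_isCyclotomicVariable_holds 2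
  obtain ⟨DW⟩ := W.nonempty_selmerDualData_holds κ γ hγ
  obtain ⟨L, hLf⟩ := exists_isSplitMultPAdicLFunctionOf hsp hf
  obtain ⟨hX, -, hint⟩ := integralKato_of_katoRat_of_mu_eq_zero_of_period W hKato
    (mu_eq_zero_of_towerGapAtTwo W hgap) hper₀ hmult κ γ hκ' hγ hγ' Dm.f hf ϖ hϖ DW
  obtain ⟨g, hg, hι⟩ := hint hsp L hLf
  have hchar := charIdeal_eq_span_of_katoIntSplit_selmerPinch W hsp hlan hμan hκ' hγ hγ' hf hLf DW hX hϖ hι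
    hg (selmerLambdaLowerBoundAtTwo_of_layerSelmer W h414 htors hsel)
  exact bsdp_of_missingPPartAt W 2 hGZK (by rw [hr]; exact zero_le_one)
    (missingPPartAt_two_split_of_charIdeal_eq_span_of_kappaCert W
      (twoAdicEulerCharRankZeroSplitMult_zero_of_greenberg W h41sp) hκ hGZK hmult hsp hL hκ' hγ hγ' hf hLf
      DW hX hϖ hι hchar)

/-- **DOOR (TOWER λ-pinch, split), CONVERSE FORM, on the PRINTED weak exceptional zero:** the inputs of the
BSD₂ door MINUS analytic rank `0`, GZK and the `κ₁` certificate, PLUS `hW : Spiess2014.thm57_weakExceptionalZero_splitMultiplicative_rat W 2`;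
`Sel_{2^∞}(E/ℚ)` finite ⇒ `L(E,1) ≠ 0 ∧ r_an(E) = 0`. GEN 6's converse verbatim, last step
`entireLFunction_one_ne_zero_of_finite_selmer_of_charIdeal_eq_span_split_of_weakEZ`. No `hGS`.
[cite: Spiess2014Invent, Thm. 5.7] [cite: Kato2004Asterisque, Thm. 17.4 (p. 273) and 17.13]
[cite: GreenbergLNM1716, §4 pp. 112–113 and Prop. 4.14 (p. 124)] [cite: MazurTateTeitelbaum1986Invent, §I.13–15 and §II] -/
theorem analyticRank_eq_zero_of_finite_selmer_of_katoRat_split_of_towerGap_of_layerSelmer_of_weakEZ {j n : ℕ}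
    (hKato : O1.KatoMultiplicativeDivisibilityRat W 2)
    (h41sp : thm41Analogue_charValue_rankZero_split_baseChange_anyPrime)
    (hW : thm57_weakExceptionalZero_splitMultiplicative_rat W 2)
    (hmod : nonempty_modularParametrizationData)
    (h414 : prop414_noFiniteSubmodule_of_not_dvd_torsionOrder)
    (hper₀ : ∀ [NeZero (W.conductorNorm ℤ)] (f : CuspForm (Gamma0 (W.conductorNorm ℤ)) 2),
      IsNewformOf W f → ∀ ϖ : ℚ, (ϖ : ℝ) * W.realPeriodRat = plusPeriod f → 0 ≤ padicValRat 2 ϖ)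
    (hgap : TowerGapAtTwo W) (htors : ¬ 2 ∣ W.torsionOrder)
    (hmult : Mult W 2) (hsp : W.HasSplitMultiplicativeReductionAtPrime 2)
    (hlan : X2.AnalyticLambdaEq W 2 (n + 1)) (hμan : X2.AnalyticMuLE W 2 0)
    (hsel : ∀ κ : ZpExtension ℚ 2, κ.IsCyclotomic →
      2 ^ n ≤ Nat.card {z : W.selmerLayer κ j // 2 • z = 0})
    (hfin : Finite (W.selmerGroupPInfty 2)) : W.entireLFunction 1 ≠ 0 ∧ W.analyticRank = 0 := by
  haveI : NeZero (W.conductorNorm ℤ) := ⟨(W.conductorNorm_pos_holds).ne'⟩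
  obtain ⟨Dm⟩ := hmod W
  have hf : IsNewformOf W Dm.f := Dm.isNewformOf
  obtain ⟨ϖ, -, hϖ, -⟩ := Dm.exists_rat_mul_realPeriodRat_eq_plusPeriod
  obtain ⟨κ, hκ', γ, hγ, hγ'⟩ := exists_isCyclotomic_isTopGenerator_isCyclotomicVariable_holds 2
  obtain ⟨DW⟩ := W.nonempty_selmerDualData_holds κ γ hγ
  obtain ⟨L, hLf⟩ := exists_isSplitMultPAdicLFunctionOf hsp hf
  obtain ⟨hX, -, hint⟩ := integralKato_of_katoRat_of_mu_eq_zero_of_period W hKato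
    (mu_eq_zero_of_towerGapAtTwo W hgap) hper₀ hmult κ γ hκ' hγ hγ' Dm.f hf ϖ hϖ DW
  obtain ⟨g, hg, hι⟩ := hint hsp L hLf
  have hchar := charIdeal_eq_span_of_katoIntSplit_selmerPinch W hsp hlan hμan hκ' hγ hγ' hf hLf DW hX hϖ hι
    hg (selmerLambdaLowerBoundAtTwo_of_layerSelmer W h414 htors hsel)
  exact entireLFunction_one_ne_zero_of_finite_selmer_of_charIdeal_eq_span_split_of_weakEZ W
    (twoAdicEulerCharRankZeroSplitMult_zero_of_greenberg W h41sp) hW hmult hsp hκ' hγ hγ' hf hLf DW hX hι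
    hchar hfin

/-- **Item 19923 (`MultLowerHalfAtTwo`) AT a split odd-torsion curve on the TOWER λ-pinch road, on the
`κ₁`-certificate:** `Typed.MissingLowerBoundAt W 2` from MEMO {K11} + PRINT {A236, `hmod`, `hGZK`, `h414`} +
CERTIFICATES {`κ₁`, tower gap, layer count, `λ_an = n + 1`, `μ_an = 0`, `hper₀`}. No `hGS`.
[cite: Miller2011LMS, Def. 1.1 (arXiv:1010.2431 p. 3)] [cite: GreenbergLNM1716, Prop. 4.14 (p. 124)] -/
theorem missingLowerBoundAt_two_split_of_katoRat_of_towerGap_of_layerSelmer_of_kappaCert {j n : ℕ}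
    (hKato : O1.KatoMultiplicativeDivisibilityRat W 2)
    (h41sp : thm41Analogue_charValue_rankZero_split_baseChange_anyPrime)
    (hκ : AnalyticKappaOneValuationAtTwo W)
    (hmod : nonempty_modularParametrizationData)
    (hGZK : rank_eq_analyticRank_of_analyticRank_le_one)
    (h414 : prop414_noFiniteSubmodule_of_not_dvd_torsionOrder)
    (hper₀ : ∀ [NeZero (W.conductorNorm ℤ)] (f : CuspForm (Gamma0 (W.conductorNorm ℤ)) 2),
      IsNewformOf W f → ∀ ϖ : ℚ, (ϖ : ℝ) * W.realPeriodRat = plusPeriod f → 0 ≤ padicValRat 2 ϖ)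
    (hgap : TowerGapAtTwo W) (htors : ¬ 2 ∣ W.torsionOrder)
    (hr : W.analyticRank = 0) (hmult : Mult W 2) (hsp : W.HasSplitMultiplicativeReductionAtPrime 2)
    (hlan : X2.AnalyticLambdaEq W 2 (n + 1)) (hμan : X2.AnalyticMuLE W 2 0)
    (hsel : ∀ κ : ZpExtension ℚ 2, κ.IsCyclotomic →
      2 ^ n ≤ Nat.card {z : W.selmerLayer κ j // 2 • z = 0}) : MissingLowerBoundAt W 2 := by
  haveI : Finite W.sha := (hGZK W (by rw [hr]; exact zero_le_one)).2
  exact (lower_and_upper_of_missingPPartAt W 2 (missingPPartAt_of_bsdp W 2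
    (bsdp_two_split_of_katoRat_of_towerGap_of_layerSelmer_of_kappaCert W hKato h41sp hκ hmod hGZK h414 hper₀
      hgap htors hr hmult hsp hlan hμan hsel))).1

/-- **Item 19922 (`MultUpperHalfAtTwo`) AT the same curve, on the `κ₁`-certificate:** `Typed.MissingUpperBoundAt W 2`
— through `BSDp W 2`. No `hGS`. [cite: Miller2011LMS, Def. 1.1 (arXiv:1010.2431 p. 3)] [cite: GreenbergLNM1716, Prop. 4.14 (p. 124)] -/
theorem missingUpperBoundAt_two_split_of_katoRat_of_towerGap_of_layerSelmer_of_kappaCert {j n : ℕ}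
    (hKato : O1.KatoMultiplicativeDivisibilityRat W 2)
    (h41sp : thm41Analogue_charValue_rankZero_split_baseChange_anyPrime)
    (hκ : AnalyticKappaOneValuationAtTwo W)
    (hmod : nonempty_modularParametrizationData)
    (hGZK : rank_eq_analyticRank_of_analyticRank_le_one)
    (h414 : prop414_noFiniteSubmodule_of_not_dvd_torsionOrder)
    (hper₀ : ∀ [NeZero (W.conductorNorm ℤ)] (f : CuspForm (Gamma0 (W.conductorNorm ℤ)) 2),
      IsNewformOf W f → ∀ ϖ : ℚ, (ϖ : ℝ) * W.realPeriodRat = plusPeriod f → 0 ≤ padicValRat 2 ϖ)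
    (hgap : TowerGapAtTwo W) (htors : ¬ 2 ∣ W.torsionOrder)
    (hr : W.analyticRank = 0) (hmult : Mult W 2) (hsp : W.HasSplitMultiplicativeReductionAtPrime 2)
    (hlan : X2.AnalyticLambdaEq W 2 (n + 1)) (hμan : X2.AnalyticMuLE W 2 0)
    (hsel : ∀ κ : ZpExtension ℚ 2, κ.IsCyclotomic →
      2 ^ n ≤ Nat.card {z : W.selmerLayer κ j // 2 • z = 0}) : MissingUpperBoundAt W 2 := by
  haveI : Finite W.sha := (hGZK W (by rw [hr]; exact zero_le_one)).2
  exact (lower_and_upper_of_missingPPartAt W 2 (missingPPartAt_of_bsdp W 2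
    (bsdp_two_split_of_katoRat_of_towerGap_of_layerSelmer_of_kappaCert W hKato h41sp hκ hmod hGZK h414 hper₀
      hgap htors hr hmult hsp hlan hμan hsel))).2

end Summit.BirchSwinnertonDyer.BirchSwinnertonDyer.Theorems.MultSelmerRank

end
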